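import Summits.CriticalPhenomena.PercolationContinuityZ3.Theorems.PercNearOneGluingNoHeavyLowerTailWorstPairExchange
import Summits.CriticalPhenomena.PercolationContinuityZ3.Theorems.PercNearOneGluingNoHeavyLowerTailOwnDisconnection
import Literature.Probability.Percolation.TwoClusterExchange
import Literature.Probability.Percolation.FoldingFibresHarris
import HarnessLib

/-!
# `NoHeavyLowerTail` (stmt-CriticalPhenomena-4575) — WORST-RELAY GLUING (U₁): a LINEAR sufficient condition for event gluing
# (all `|A|`), proved here for `|A| ≤ 2` and for observers at least as reliable as the worst relay

Support file (prover prim-gen-kcluster gen 4, k-cluster conditional-association line; `--supports stmt-CriticalPhenomena-4575`).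
No definitions, no named facts, no sorries.

Setting: `μ = prodBernoulli w` on `Fin n`, observer `o`, sink `c`, finite relay set `A`, `d_x := μ(x ↮ c)`,
`a₁ ∈ A` a WORST relay (`d_a ≤ d_{a₁}` for all `a ∈ A`; nothing is assumed about the order of the other relays).

WORST-RELAY GLUING (U₁):   `μ({o ↮ c} ∩ {o ↔ A}) ≤ μ({a₁ ↮ c} ∩ {o ↔ A})`,   `{o ↔ A} := ⋃_{a∈A} {o ↔ a}`,
i.e. `μ(o ↮ c | o ↔ A) ≤ μ(a₁ ↮ c | o ↔ A)`: given that the observer reaches the relay set, it is at least as likely as the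
worst relay to reach the sink.  Equivalently `μ({o ↔ A} ∩ {o ↮ c} ∩ {a₁ ↔ c}) ≤ μ({o ↔ A} ∩ {o ↔ c} ∩ {a₁ ↮ c})`.
It is LINEAR in the cell masses (the ordering hypotheses `d_a ≤ d_{a₁}` are linear too).

* `eventGluing_of_worstRelayGluing`: (U₁) for all relay sets ⇒ EVENT GLUING `μ({o ↮ c} ∩ {o ↔ A}) ≤ max_a d_a`
  (one line: `≤ μ(a₁ ↮ c) = max d`), hence `additiveGluing_of_worstRelayGluing` (stmt-4576) and
  `noHeavyLowerTail_of_worstRelayGluing` (stmt-4575) by the landed glue.  (Indeed (U₁) + Harris give the sharper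
  `μ({o ↮ c} ∩ {o ↔ A}) ≤ μ(o ↔ A) · max_a d_a`.)
* `worstRelayGluing_of_observer` (PROVED, all `|A|`): (U₁) holds whenever `μ(o ↮ c) ≤ μ(a₁ ↮ c)` — one application of the
  two-cluster exchange inequality (BHK 2006 Thm 1.5, `twoClusterExchange` with `s = o`, `t = a₁`): on `{o ↮ a₁}` the event
  `{o ↔ A}` is increasing in `C_o`, `{o ↔ c}` increasing in `C_o`, `{a₁ ↔ c}` increasing in `C_{a₁}`.  (In this regime event
  gluing itself is trivial, `X ≤ μ(o ↮ c) ≤ d_{a₁}`; the content of (U₁) is the complementary regime.)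
* `worstRelayGluing_card_le_two` (PROVED): (U₁) for `|A| ≤ 2` — for `A = {a₁, y}` it is `μ({o↔y}∩{a₁↔c}∩{y↮c}) ≤
  μ({o↔y}∩{y↔c}∩{a₁↮c})`, which follows from the landed `OwnDisconnection.diamond` and `d_y ≤ d_{a₁}`.
RELATION TO KOZMA–NITZAN (arXiv:2401.12397): (U₁) is their pre-FKG inequality (3) `P(o↔b, o↔A) ≥ P(o↔A, a↔b)` AT THE LEAST
RELIABLE RELAY `a = a₁` (`preFKG_worst_iff`) — the form in which they prove it for `|A| = 2` (Thm 1) and for separating `|A| = 3`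
(Thm 3); it implies their Conjecture 2 and Conjecture 1 (`kozmaNitzan_conjecture1_of_worstRelayGluing`), hence is at least as hard as
those (calibration, like `Theorems.kozmaNitzan_conjecture1_of_topWeighted`); what it adds is the WITNESS: the census says the minimiser in (3)
may always be taken to be `argmax_a μ(a ↮ b)`.
Census (exact partition DP, seat folder num/t_U1.py, t_M1.py, t_SD.py, t_Tj.py): 0 violations of (U₁) in ≈ 4 000 instances
(`n ≤ 8`, `|A| ≤ 5`, random / two-scale / glued-locus; ratio → 1 only at the glue locus); the analogous statement with any
non-worst relay in place of `a₁` fails (25–70 %), and every product ("set diamond") strengthening and every termwise piece over a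
worst-first decomposition of `{o ↔ A ∖ a₁}` fails — only the full linear statement holds.  ttrl request `u1-worst-relay-gluing`.
-/

noncomputable section

namespace Summit.CriticalPhenomena.PercolationContinuityZ3.Theorems

open MeasureTheory Set Literature.Probability.LatticeModels Literature.Probability.Percolation
open Summit.CriticalPhenomena.PercolationContinuityZ3.Theses.PercNearOneGluing
open scoped Classical BigOperators

namespace WorstRelayGluing

variable {n : ℕ}

/-- **Worst-relay gluing ⇒ event gluing (all relay sets).**  Hypothesis (verbatim the conjecture (U₁)): for every finite weighted
graph, observer `o`, sink `c`, relay set `A` and worst relay `a₁ ∈ A` (`μ(a ↮ c) ≤ μ(a₁ ↮ c)` on `A`),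
`μ({o ↮ c} ∩ ⋃_{a∈A}{o ↔ a}) ≤ μ({a₁ ↮ c} ∩ ⋃_{a∈A}{o ↔ a})`.  Conclusion: event gluing. [this file] -/
theorem eventGluing_of_worstRelayGluing
    (hU1 : ∀ (n : ℕ) (w : Sym2 (Fin n) → unitInterval) (A : Finset (Fin n)) (o c a₁ : Fin n), a₁ ∈ A →
      (∀ a ∈ A, (prodBernoulli w).real (openConn a c : Set (BondConfig (Fin n)))ᶜ ≤
        (prodBernoulli w).real (openConn a₁ c : Set (BondConfig (Fin n)))ᶜ) →
      (prodBernoulli w).real ((openConn o c : Set (BondConfig (Fin n)))ᶜ ∩ ⋃ a ∈ A, openConn o a) ≤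
        (prodBernoulli w).real ((openConn a₁ c : Set (BondConfig (Fin n)))ᶜ ∩ ⋃ a ∈ A, openConn o a)) :
    ∀ (n : ℕ) (w : Sym2 (Fin n) → unitInterval) (A : Finset (Fin n)) (o c : Fin n) (s : ℝ), 0 ≤ s →
      (∀ a ∈ A, (prodBernoulli w).real (openConn a c : Set (BondConfig (Fin n)))ᶜ ≤ s) →
      (prodBernoulli w).real ((openConn o c : Set (BondConfig (Fin n)))ᶜ ∩ ⋃ a ∈ A, openConn o a) ≤ s := by
  intro n w A o c s hs hcut
  set μ := prodBernoulli w with hμ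
  set d : Fin n → ℝ := fun x => μ.real (openConn x c : Set (BondConfig (Fin n)))ᶜ with hd
  rcases A.eq_empty_or_nonempty with hAe | hAne
  · subst hAe
    simp only [Finset.notMem_empty, Set.iUnion_of_empty, Set.iUnion_empty, Set.inter_empty,
      measureReal_empty]
    exact hs
  obtain ⟨a₁, ha₁, hmax⟩ := Finset.exists_max_image A d hAne
  calc μ.real ((openConn o c : Set (BondConfig (Fin n)))ᶜ ∩ ⋃ a ∈ A, openConn o a)
      ≤ μ.real ((openConn a₁ c : Set (BondConfig (Fin n)))ᶜ ∩ ⋃ a ∈ A, openConn o a) := hU1 n w A o c a₁ ha₁ hmax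
    _ ≤ μ.real (openConn a₁ c : Set (BondConfig (Fin n)))ᶜ := measureReal_mono inter_subset_left
    _ ≤ s := hcut a₁ ha₁

/-- **Worst-relay gluing ⇒ `AdditiveGluing`** (stmt-CriticalPhenomena-4576). [this file] -/
theorem additiveGluing_of_worstRelayGluing
    (hU1 : ∀ (n : ℕ) (w : Sym2 (Fin n) → unitInterval) (A : Finset (Fin n)) (o c a₁ : Fin n), a₁ ∈ A →
      (∀ a ∈ A, (prodBernoulli w).real (openConn a c : Set (BondConfig (Fin n)))ᶜ ≤
        (prodBernoulli w).real (openConn a₁ c : Set (BondConfig (Fin n)))ᶜ) →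
      (prodBernoulli w).real ((openConn o c : Set (BondConfig (Fin n)))ᶜ ∩ ⋃ a ∈ A, openConn o a) ≤
        (prodBernoulli w).real ((openConn a₁ c : Set (BondConfig (Fin n)))ᶜ ∩ ⋃ a ∈ A, openConn o a)) :
    Summit.CriticalPhenomena.PercolationContinuityZ3.Theses.PercNearOneGluing.AdditiveGluing :=
  additiveGluing_of_eventGluing (eventGluing_of_worstRelayGluing hU1)

/-- **Worst-relay gluing ⇒ `NoHeavyLowerTail`** (stmt-CriticalPhenomena-4575), through the landed glue
`event gluing ⇒ AdditiveGluing ⇒ NearOneGluing ⇒ residual ⇒ crux`. [this file] -/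
theorem noHeavyLowerTail_of_worstRelayGluing
    (hU1 : ∀ (n : ℕ) (w : Sym2 (Fin n) → unitInterval) (A : Finset (Fin n)) (o c a₁ : Fin n), a₁ ∈ A →
      (∀ a ∈ A, (prodBernoulli w).real (openConn a c : Set (BondConfig (Fin n)))ᶜ ≤
        (prodBernoulli w).real (openConn a₁ c : Set (BondConfig (Fin n)))ᶜ) →
      (prodBernoulli w).real ((openConn o c : Set (BondConfig (Fin n)))ᶜ ∩ ⋃ a ∈ A, openConn o a) ≤
        (prodBernoulli w).real ((openConn a₁ c : Set (BondConfig (Fin n)))ᶜ ∩ ⋃ a ∈ A, openConn o a)) :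
    Summit.CriticalPhenomena.PercolationContinuityZ3.Theses.PercNearOneGluing.NoHeavyLowerTail :=
  noHeavyLowerTail_of_eventGluing (eventGluing_of_worstRelayGluing hU1)

/-- **(U₁) for reliable observers (PROVED, every relay set).**  If `μ(x ↮ c) ≥ μ(o ↮ c)` (equivalently `μ(x ↔ c) ≤ μ(o ↔ c)`)
then for EVERY finite vertex set `A`: `μ({o ↮ c} ∩ {o ↔ A}) ≤ μ({x ↮ c} ∩ {o ↔ A})`.  One application of the two-cluster
exchange inequality with `s = o`, `t = x`. [this file] -/
theorem worstRelayGluing_of_observer (w : Sym2 (Fin n) → unitInterval) (A : Finset (Fin n)) (o c x : Fin n)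
    (hox : (prodBernoulli w).real (openConn o c : Set (BondConfig (Fin n)))ᶜ ≤
      (prodBernoulli w).real (openConn x c : Set (BondConfig (Fin n)))ᶜ) :
    (prodBernoulli w).real ((openConn o c : Set (BondConfig (Fin n)))ᶜ ∩ ⋃ a ∈ A, openConn o a) ≤
      (prodBernoulli w).real ((openConn x c : Set (BondConfig (Fin n)))ᶜ ∩ ⋃ a ∈ A, openConn o a) := by
  haveI : IsProbabilityMeasure (prodBernoulli w) := inferInstance
  set μ := prodBernoulli w with hμ
  set U : Set (BondConfig (Fin n)) := ⋃ a ∈ A, (openConn o a : Set (BondConfig (Fin n))) with hU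
  -- reduce to the cross terms:  μ(U ∩ {o↮c} ∩ {x↔c}) ≤ μ(U ∩ {o↔c} ∩ {x↮c})
  have e1 : μ.real ((openConn o c : Set (BondConfig (Fin n)))ᶜ ∩ U) =
      μ.real (U ∩ (openConn o c)ᶜ ∩ openConn x c) + μ.real (U ∩ (openConn o c)ᶜ ∩ (openConn x c)ᶜ) := by
    rw [Set.inter_comm, OwnDisconnection.split w (U ∩ (openConn o c)ᶜ) (openConn x c)]
  have e2 : μ.real ((openConn x c : Set (BondConfig (Fin n)))ᶜ ∩ U) =
      μ.real (U ∩ (openConn x c)ᶜ ∩ openConn o c) + μ.real (U ∩ (openConn x c)ᶜ ∩ (openConn o c)ᶜ) := by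
    rw [Set.inter_comm, OwnDisconnection.split w (U ∩ (openConn x c)ᶜ) (openConn o c)]
  have e3 : (U ∩ (openConn x c)ᶜ ∩ (openConn o c)ᶜ : Set (BondConfig (Fin n))) = U ∩ (openConn o c)ᶜ ∩ (openConn x c)ᶜ := by
    ext ω; simp only [mem_inter_iff, mem_compl_iff]; tauto
  rw [e1, e2, e3]
  suffices h : μ.real (U ∩ (openConn o c)ᶜ ∩ openConn x c) ≤ μ.real (U ∩ (openConn x c)ᶜ ∩ openConn o c) by linarith
  -- numbers
  have hxc : μ.real (openConn x c : Set (BondConfig (Fin n))) ≤ μ.real (openConn o c : Set (BondConfig (Fin n))) := by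
    have h1 := probReal_compl_eq_one_sub (μ := μ) (MeasurableSet.of_discrete (s := (openConn x c : Set (BondConfig (Fin n)))))
    have h2 := probReal_compl_eq_one_sub (μ := μ) (MeasurableSet.of_discrete (s := (openConn o c : Set (BondConfig (Fin n)))))
    linarith
  by_cases hoxeq : o = x
  · subst hoxeq
    exact le_refl _
  -- two-cluster exchange with s = o, t = x:  A₁ = U (+), B₁ = {x↔c} (−), A₂ = {o↔c} (+), B₂ = univ (−)
  have hex := twoClusterExchange w hoxeq (A₁ := U) (A₂ := openConn o c) (B₁ := openConn x c) (B₂ := Set.univ)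
    (by
      intro ω ω' h1 h2 hω
      simp only [hU, mem_iUnion, exists_prop] at hω ⊢
      obtain ⟨a, ha, hωa⟩ := hω
      exact ⟨a, ha, typePlus_openConn o x a h1 h2 hωa⟩)
    (fun ω ω' h1 h2 hω => typePlus_openConn o x c h1 h2 hω)
    (fun ω ω' h1 h2 hω => typeMinus_openConn o x c h1 h2 hω)
    (fun ω ω' _ _ _ => mem_univ _)
  -- identify the four events
  have s1 : ((openConn o x : Set (BondConfig (Fin n)))ᶜ ∩ (U ∩ openConn x c)) = U ∩ (openConn o c)ᶜ ∩ openConn x c := by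
    ext ω
    simp only [mem_inter_iff, mem_compl_iff, openConn, mem_setOf_eq]
    constructor
    · rintro ⟨hox', hUω, hxc'⟩
      exact ⟨⟨hUω, fun hoc => hox' (SimpleGraph.Reachable.trans hoc (SimpleGraph.Reachable.symm hxc'))⟩, hxc'⟩
    · rintro ⟨⟨hUω, hoc⟩, hxc'⟩
      exact ⟨fun hox' => hoc (SimpleGraph.Reachable.trans hox' hxc'), hUω, hxc'⟩
  have s2 : ((openConn o x : Set (BondConfig (Fin n)))ᶜ ∩ (U ∩ openConn o c)) = U ∩ (openConn x c)ᶜ ∩ openConn o c := by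
    ext ω
    simp only [mem_inter_iff, mem_compl_iff, openConn, mem_setOf_eq]
    constructor
    · rintro ⟨hox', hUω, hoc⟩
      exact ⟨⟨hUω, fun hxc' => hox' (SimpleGraph.Reachable.trans hoc (SimpleGraph.Reachable.symm hxc'))⟩, hoc⟩
    · rintro ⟨⟨hUω, hxc'⟩, hoc⟩
      exact ⟨fun hox' => hxc' (SimpleGraph.Reachable.trans (SimpleGraph.Reachable.symm hox') hoc), hUω, hoc⟩
  have s3 : ((openConn o x : Set (BondConfig (Fin n)))ᶜ ∩ (openConn o c ∩ Set.univ)) = openConn o c ∩ (openConn o x)ᶜ := by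
    rw [Set.inter_univ, Set.inter_comm]
  have s4 : ((openConn o x : Set (BondConfig (Fin n)))ᶜ ∩ (openConn x c ∩ Set.univ)) = openConn x c ∩ (openConn o x)ᶜ := by
    rw [Set.inter_univ, Set.inter_comm]
  rw [s1, s2, s3, s4] at hex
  -- μ({x↔c}∖{o↔x}) ≤ μ({o↔c}∖{o↔x})  since the removed parts coincide ({o↔x↔c})
  set Mo := μ.real (openConn o c ∩ (openConn o x)ᶜ : Set (BondConfig (Fin n))) with hMo
  set Mx := μ.real (openConn x c ∩ (openConn o x)ᶜ : Set (BondConfig (Fin n))) with hMx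
  have hM : Mx ≤ Mo := by
    have t1 := OwnDisconnection.split w (openConn o c : Set (BondConfig (Fin n))) (openConn o x)
    have t2 := OwnDisconnection.split w (openConn x c : Set (BondConfig (Fin n))) (openConn o x)
    have same : (openConn x c ∩ openConn o x : Set (BondConfig (Fin n))) = openConn o c ∩ openConn o x := by
      ext ω
      simp only [mem_inter_iff, openConn, mem_setOf_eq]
      constructor
      · rintro ⟨hxc', hox'⟩; exact ⟨SimpleGraph.Reachable.trans hox' hxc', hox'⟩
      · rintro ⟨hoc, hox'⟩; exact ⟨SimpleGraph.Reachable.trans (SimpleGraph.Reachable.symm hox') hoc, hox'⟩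
    rw [same] at t2
    linarith
  set V := μ.real (U ∩ (openConn o c)ᶜ ∩ openConn x c) with hV
  set R := μ.real (U ∩ (openConn x c)ᶜ ∩ openConn o c) with hR
  have hV0 : 0 ≤ V := measureReal_nonneg
  have hR0 : 0 ≤ R := measureReal_nonneg
  have hVle : V ≤ Mx := measureReal_mono (by
    rintro ω ⟨⟨_, hoc⟩, hxc'⟩
    refine ⟨hxc', fun hox' => hoc ?_⟩
    exact SimpleGraph.Reachable.trans hox' hxc')
  -- hex : V * Mo ≤ R * Mx
  rcases eq_or_lt_of_le (measureReal_nonneg : 0 ≤ Mo) with hMo0 | hMopos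
  · have : Mx = 0 := le_antisymm (by rw [hMo0]; exact hM) measureReal_nonneg
    linarith
  · have h2 : V * Mo ≤ R * Mo := le_trans hex (mul_le_mul_of_nonneg_left hM hR0)
    exact le_of_mul_le_mul_right h2 hMopos

/-- **(U₁) for `|A| ≤ 2` (PROVED).**  For `A = {a₁, y}` with `μ(y ↮ c) ≤ μ(a₁ ↮ c)` the statement is
`μ({o↔y} ∩ {a₁↔c} ∩ {y↮c}) ≤ μ({o↔y} ∩ {y↔c} ∩ {a₁↮c})`, from the landed `OwnDisconnection.diamond`. [this file] -/
theorem worstRelayGluing_card_le_two (w : Sym2 (Fin n) → unitInterval) (A : Finset (Fin n)) (o c a₁ : Fin n)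
    (hA : A.card ≤ 2) (ha₁ : a₁ ∈ A)
    (hworst : ∀ a ∈ A, (prodBernoulli w).real (openConn a c : Set (BondConfig (Fin n)))ᶜ ≤
      (prodBernoulli w).real (openConn a₁ c : Set (BondConfig (Fin n)))ᶜ) :
    (prodBernoulli w).real ((openConn o c : Set (BondConfig (Fin n)))ᶜ ∩ ⋃ a ∈ A, openConn o a) ≤
      (prodBernoulli w).real ((openConn a₁ c : Set (BondConfig (Fin n)))ᶜ ∩ ⋃ a ∈ A, openConn o a) := by
  set μ := prodBernoulli w with hμ
  -- write A = insert a₁ (A.erase a₁), with |A.erase a₁| ≤ 1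
  have hA' : (A.erase a₁).card ≤ 1 := by
    have := Finset.card_erase_of_mem ha₁; omega
  have hAeq : A = insert a₁ (A.erase a₁) := (Finset.insert_erase ha₁).symm
  -- the union splits as {o↔a₁} ∪ ⋃_{a ∈ A.erase a₁} {o↔a}
  have hUeq : (⋃ a ∈ A, (openConn o a : Set (BondConfig (Fin n)))) =
      (openConn o a₁ : Set (BondConfig (Fin n))) ∪ ⋃ a ∈ A.erase a₁, (openConn o a : Set (BondConfig (Fin n))) := by
    conv_lhs => rw [hAeq]
    exact Finset.set_biUnion_insert a₁ (A.erase a₁) _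
  rw [hUeq]
  rcases Nat.lt_or_ge (A.erase a₁).card 1 with h0 | h1
  · -- A = {a₁}
    have he : A.erase a₁ = ∅ := Finset.card_eq_zero.1 (by omega)
    rw [he]
    simp only [Finset.notMem_empty, Set.iUnion_of_empty, Set.iUnion_empty, Set.union_empty]
    apply le_of_eq
    congr 1
    ext ω
    simp only [mem_inter_iff, mem_compl_iff, openConn, mem_setOf_eq]
    constructor
    · rintro ⟨hoc, hoa⟩
      exact ⟨fun hac => hoc (SimpleGraph.Reachable.trans hoa hac), hoa⟩
    · rintro ⟨hac, hoa⟩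
      exact ⟨fun hoc => hac (SimpleGraph.Reachable.trans (SimpleGraph.Reachable.symm hoa) hoc), hoa⟩
  · -- A = {a₁, y}
    obtain ⟨y, hy⟩ := Finset.card_eq_one.1 (le_antisymm hA' h1)
    rw [hy]
    simp only [Finset.mem_singleton, Set.iUnion_iUnion_eq_left]
    have hyA : y ∈ A.erase a₁ := by rw [hy]; exact Finset.mem_singleton_self y
    have hyne : y ≠ a₁ := (Finset.mem_erase.1 hyA).1
    have hyw := hworst y (Finset.mem_of_mem_erase hyA)
    -- split the union as {o↔a₁} ⊔ ({o↔y} ∖ {o↔a₁})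
    have spl : ∀ F : Set (BondConfig (Fin n)), μ.real (F ∩ (openConn o a₁ ∪ openConn o y)) =
        μ.real (F ∩ openConn o a₁) + μ.real (F ∩ (openConn o y ∩ (openConn o a₁)ᶜ)) := by
      intro F
      have hdisj : Disjoint (F ∩ openConn o a₁) (F ∩ (openConn o y ∩ (openConn o a₁)ᶜ)) := by
        rw [Set.disjoint_left]
        rintro ω ⟨_, h1'⟩ ⟨_, _, h2'⟩; exact h2' h1'
      have hun : (F ∩ (openConn o a₁ ∪ openConn o y) : Set (BondConfig (Fin n))) =
          (F ∩ openConn o a₁) ∪ (F ∩ (openConn o y ∩ (openConn o a₁)ᶜ)) := by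
        ext ω; simp only [mem_inter_iff, mem_union, mem_compl_iff]; tauto
      rw [hun, measureReal_union hdisj MeasurableSet.of_discrete]
    rw [spl, spl]
    -- on {o↔a₁} both sides agree
    have same : μ.real ((openConn o c : Set (BondConfig (Fin n)))ᶜ ∩ openConn o a₁) =
        μ.real ((openConn a₁ c : Set (BondConfig (Fin n)))ᶜ ∩ openConn o a₁) := by
      congr 1
      ext ω
      simp only [mem_inter_iff, mem_compl_iff, openConn, mem_setOf_eq]
      constructor
      · rintro ⟨hoc, hoa⟩
        exact ⟨fun hac => hoc (SimpleGraph.Reachable.trans hoa hac), hoa⟩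
      · rintro ⟨hac, hoa⟩
        exact ⟨fun hoc => hac (SimpleGraph.Reachable.trans (SimpleGraph.Reachable.symm hoa) hoc), hoa⟩
    rw [same]
    -- on {o↔y}∖{o↔a₁}: compare μ(P ∩ {o↮c}) ≤ μ(P ∩ {a₁↮c}), i.e. μ(P ∩ {a₁↔c}) ≤ μ(P ∩ {o↔c})
    set P : Set (BondConfig (Fin n)) := openConn o y ∩ (openConn o a₁)ᶜ with hP
    suffices h : μ.real (P ∩ openConn a₁ c) ≤ μ.real (P ∩ openConn o c) by
      have t1 := OwnDisconnection.split w P (openConn o c)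
      have t2 := OwnDisconnection.split w P (openConn a₁ c)
      have c1 : μ.real ((openConn o c : Set (BondConfig (Fin n)))ᶜ ∩ P) = μ.real (P ∩ (openConn o c)ᶜ) := by rw [Set.inter_comm]
      have c2 : μ.real ((openConn a₁ c : Set (BondConfig (Fin n)))ᶜ ∩ P) = μ.real (P ∩ (openConn a₁ c)ᶜ) := by rw [Set.inter_comm]
      rw [c1, c2]; linarith
    -- identify with the diamond cells: P ∩ {a₁↔c} = {o↔y}∩{a₁↔c}∩{y↮c},  P ∩ {o↔c} = {o↔y}∩{y↔c}∩{a₁↮c}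
    have i1 : (P ∩ openConn a₁ c : Set (BondConfig (Fin n))) = openConn o y ∩ openConn a₁ c ∩ (openConn y c)ᶜ := by
      ext ω
      simp only [hP, mem_inter_iff, mem_compl_iff, openConn, mem_setOf_eq]
      constructor
      · rintro ⟨⟨hoy, hoa⟩, hac⟩
        exact ⟨⟨hoy, hac⟩, fun hyc => hoa (SimpleGraph.Reachable.trans (SimpleGraph.Reachable.trans hoy hyc) (SimpleGraph.Reachable.symm hac))⟩
      · rintro ⟨⟨hoy, hac⟩, hyc⟩
        exact ⟨⟨hoy, fun hoa => hyc (SimpleGraph.Reachable.trans (SimpleGraph.Reachable.trans (SimpleGraph.Reachable.symm hoy) hoa) hac)⟩, hac⟩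
    have i2 : (P ∩ openConn o c : Set (BondConfig (Fin n))) = openConn o y ∩ openConn y c ∩ (openConn a₁ c)ᶜ := by
      ext ω
      simp only [hP, mem_inter_iff, mem_compl_iff, openConn, mem_setOf_eq]
      constructor
      · rintro ⟨⟨hoy, hoa⟩, hoc⟩
        exact ⟨⟨hoy, SimpleGraph.Reachable.trans (SimpleGraph.Reachable.symm hoy) hoc⟩, fun hac => hoa (SimpleGraph.Reachable.trans hoc (SimpleGraph.Reachable.symm hac))⟩
      · rintro ⟨⟨hoy, hyc⟩, hac⟩
        exact ⟨⟨hoy, fun hoa => hac (SimpleGraph.Reachable.trans (SimpleGraph.Reachable.symm hoa) (SimpleGraph.Reachable.trans hoy hyc))⟩, SimpleGraph.Reachable.trans hoy hyc⟩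
    rw [i1, i2]
    -- diamond: PG · F ≤ PF · G with F = μ({y↔c}∩{a₁↮c}) ≥ G = μ({a₁↔c}∩{y↮c})
    have hdia := diamond w o y a₁ c
    set PG := μ.real (openConn o y ∩ openConn a₁ c ∩ (openConn y c)ᶜ : Set (BondConfig (Fin n))) with hPG
    set PF := μ.real (openConn o y ∩ openConn y c ∩ (openConn a₁ c)ᶜ : Set (BondConfig (Fin n))) with hPF
    set F := μ.real (openConn y c ∩ (openConn a₁ c)ᶜ : Set (BondConfig (Fin n))) with hF
    set G := μ.real (openConn a₁ c ∩ (openConn y c)ᶜ : Set (BondConfig (Fin n))) with hG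
    have hGF : G ≤ F := by
      have t1 := OwnDisconnection.split w ((openConn a₁ c : Set (BondConfig (Fin n)))ᶜ) (openConn y c)
      have t2 := OwnDisconnection.split w ((openConn y c : Set (BondConfig (Fin n)))ᶜ) (openConn a₁ c)
      have c1 : ((openConn a₁ c : Set (BondConfig (Fin n)))ᶜ ∩ openConn y c) = openConn y c ∩ (openConn a₁ c)ᶜ := Set.inter_comm _ _
      have c2 : ((openConn y c : Set (BondConfig (Fin n)))ᶜ ∩ openConn a₁ c) = openConn a₁ c ∩ (openConn y c)ᶜ := Set.inter_comm _ _
      have c3 : ((openConn y c : Set (BondConfig (Fin n)))ᶜ ∩ (openConn a₁ c)ᶜ) = (openConn a₁ c)ᶜ ∩ (openConn y c)ᶜ := Set.inter_comm _ _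
      rw [c1] at t1; rw [c2, c3] at t2
      linarith
    have hPGle : PG ≤ G := measureReal_mono (fun ω hω => ⟨hω.1.2, hω.2⟩)
    have hPF0 : 0 ≤ PF := measureReal_nonneg
    rcases eq_or_lt_of_le (measureReal_nonneg : 0 ≤ F) with hF0 | hFpos
    · have hG0 : G = 0 := le_antisymm (by rw [hF0]; exact hGF) measureReal_nonneg
      linarith
    · have h2 : PG * F ≤ PF * F := le_trans hdia (mul_le_mul_of_nonneg_left hGF hPF0)
      exact le_of_mul_le_mul_right h2 hFpos

/-- **(U₁) is Kozma–Nitzan's pre-FKG inequality (3) at the least reliable relay**: on one graph,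
`μ({o ↮ c} ∩ U) ≤ μ({a₁ ↮ c} ∩ U)` is the same as `μ({a₁ ↔ c} ∩ U) ≤ μ({o ↔ c} ∩ U)` (`U = {o ↔ A}`), i.e.
`P(o ↔ c, o ↔ A) ≥ P(a₁ ↔ c, o ↔ A)` — the form in which Kozma–Nitzan prove their pre-FKG conjecture for `|A| = 2`
(Thm 1) and for separating `|A| = 3` (Thm 3).
[cite: KozmaNitzan2024, eq. (3) p. 3 and Thm 3 (p. 10): "(3) holds for a₃", a₃ the relay minimising P(a ↔ b)] -/
theorem preFKG_worst_iff (w : Sym2 (Fin n) → unitInterval) (A : Finset (Fin n)) (o c a₁ : Fin n) :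
    (prodBernoulli w).real ((openConn o c : Set (BondConfig (Fin n)))ᶜ ∩ ⋃ a ∈ A, openConn o a) ≤
        (prodBernoulli w).real ((openConn a₁ c : Set (BondConfig (Fin n)))ᶜ ∩ ⋃ a ∈ A, openConn o a) ↔
      (prodBernoulli w).real ((openConn a₁ c : Set (BondConfig (Fin n))) ∩ ⋃ a ∈ A, openConn o a) ≤
        (prodBernoulli w).real ((openConn o c : Set (BondConfig (Fin n))) ∩ ⋃ a ∈ A, openConn o a) := by
  set μ := prodBernoulli w with hμ
  set U : Set (BondConfig (Fin n)) := ⋃ a ∈ A, (openConn o a : Set (BondConfig (Fin n))) with hU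
  have t1 := OwnDisconnection.split w U (openConn o c)
  have t2 := OwnDisconnection.split w U (openConn a₁ c)
  rw [Set.inter_comm ((openConn o c : Set (BondConfig (Fin n)))ᶜ), Set.inter_comm ((openConn a₁ c : Set (BondConfig (Fin n)))ᶜ),
    Set.inter_comm (openConn a₁ c : Set (BondConfig (Fin n))), Set.inter_comm (openConn o c : Set (BondConfig (Fin n)))]
  constructor <;> intro h <;> linarith

/-- **Calibration: worst-relay gluing (U₁) ⇒ Kozma–Nitzan's Conjecture 1 (post-FKG)** `P(o ↔ b) ≥ P(o ↔ A) · min_a P(a ↔ b)`,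
in the tree's form `(∀ a ∈ A, t ≤ μ(a ↔ b)) → μ(o ↔ A) · t ≤ μ(o ↔ b)`: by (U₁) and Harris (increasing × decreasing),
`μ({o↮b} ∩ {o↔A}) ≤ μ({a₁↮b} ∩ {o↔A}) ≤ μ(o ↔ A) · μ(a₁ ↮ b)`.  So (U₁) is at least as strong as KN's open Conjecture 1
(which implies their Conjecture 3 = near-one gluing and `θ(p_c) = 0`, `KozmaNitzanConjecture1ImpliesPercolationContinuityZ3`).
[cite: KozmaNitzan2024, Conjecture 1 (p. 3)] -/
theorem kozmaNitzan_conjecture1_of_worstRelayGluing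
    (hU1 : ∀ (n : ℕ) (w : Sym2 (Fin n) → unitInterval) (A : Finset (Fin n)) (o c a₁ : Fin n), a₁ ∈ A →
      (∀ a ∈ A, (prodBernoulli w).real (openConn a c : Set (BondConfig (Fin n)))ᶜ ≤
        (prodBernoulli w).real (openConn a₁ c : Set (BondConfig (Fin n)))ᶜ) →
      (prodBernoulli w).real ((openConn o c : Set (BondConfig (Fin n)))ᶜ ∩ ⋃ a ∈ A, openConn o a) ≤
        (prodBernoulli w).real ((openConn a₁ c : Set (BondConfig (Fin n)))ᶜ ∩ ⋃ a ∈ A, openConn o a)) :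
    ∀ (n : ℕ) (w : Sym2 (Fin n) → unitInterval) (A : Finset (Fin n)) (o b : Fin n) (t : ℝ),
      (∀ a ∈ A, t ≤ (prodBernoulli w).real (openConn a b)) →
        (prodBernoulli w).real (⋃ a ∈ A, openConn o a) * t ≤ (prodBernoulli w).real (openConn o b) := by
  intro n w A o b t ht
  haveI : IsProbabilityMeasure (prodBernoulli w) := inferInstance
  set μ := prodBernoulli w with hμ
  set U : Set (BondConfig (Fin n)) := ⋃ a ∈ A, (openConn o a : Set (BondConfig (Fin n))) with hU
  set d : Fin n → ℝ := fun x => μ.real (openConn x b : Set (BondConfig (Fin n)))ᶜ with hd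
  rcases A.eq_empty_or_nonempty with hAe | hAne
  · have hU0 : U = ∅ := by rw [hU, hAe]; simp
    rw [hU0, measureReal_empty, zero_mul]; exact measureReal_nonneg
  obtain ⟨a₁, ha₁, hmax⟩ := Finset.exists_max_image A d hAne
  have h1 := hU1 n w A o b a₁ ha₁ hmax
  -- Harris: μ({a₁↮b} ∩ U) ≤ μ(U) · μ(a₁ ↮ b)
  have hUup : IsUpperSet U := isUpperSet_iUnion₂ fun a _ => isUpperSet_openConn o a
  have hH := prodBernoulli_harris_upper_lower_via_fibres w hUup (isUpperSet_openConn a₁ b).compl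
  rw [Set.inter_comm] at h1
  have h1' : μ.real (U ∩ (openConn o b)ᶜ) ≤ μ.real U * d a₁ := by
    have e : ((openConn a₁ b : Set (BondConfig (Fin n)))ᶜ ∩ U) = U ∩ (openConn a₁ b)ᶜ := Set.inter_comm _ _
    rw [e] at h1
    exact le_trans h1 hH
  have hsplit := OwnDisconnection.split w U (openConn o b)
  have hd1 : d a₁ = 1 - μ.real (openConn a₁ b : Set (BondConfig (Fin n))) := by
    simp only [hd]; exact probReal_compl_eq_one_sub MeasurableSet.of_discrete
  have hta : t ≤ μ.real (openConn a₁ b : Set (BondConfig (Fin n))) := ht a₁ ha₁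
  have hUn : 0 ≤ μ.real U := measureReal_nonneg
  have hmono : μ.real (U ∩ openConn o b) ≤ μ.real (openConn o b : Set (BondConfig (Fin n))) :=
    measureReal_mono inter_subset_right
  nlinarith [mul_le_mul_of_nonneg_left hta hUn]

end WorstRelayGluing

end Summit.CriticalPhenomena.PercolationContinuityZ3.Theorems

end
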